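import Summits.QuantumFields.YangMills.Theorems.BalabanUVNodesN21MinimiserResponseImplicitFunction
import Literature.MathematicalPhysics.QuantumFieldTheory.Balaban1983to89.B11Claim309UAnalytic

/-!
# N21 (NE7c) · THE MINIMISER'S RESPONSE FROM [14] PROP. 6's CONTRACTION: the branch hypotheses of the response road's
# NODE-O clause in the SHAPE PRINT GIVES THEM — fixed points of a uniformly contracting analytic family (116)–(121)

Width seat `pub-ymgap-dag-n21-w7` (g0, second wave; dag-lead WIDTH-209 N21 piece 1 «RADIAL TRANSVERSALITY (α)»), node
N21 = NE7c (NOT PRINTED in [Bałaban 1983–89], NOT proved), lane K3⁷ `SpineGivenEndpointR13SepCoPH`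
(stmt-QuantumFields-20544, `--kind proof --supports … --as helper`).  File 2 of this seat; consumes BY NAME lit-balaban
r08 g9's [folklore] `B11Claim309UAnalytic.analyticAt_fix_of_norm_lt_one` (the selected fixed point of a uniformly
contracting analytic family is analytic in the parameter), this seat's file 1 `…N21MinimiserResponseImplicitFunction`
(p607125 ✓: ★★ `psiClause_differentiableOn_of_criticalBranch`), n21-w3 f7 `…N21ExponentialChartFieldStrength`
(`isOpen_regularConfigs`, `isOpen_unitConfigs`, `differentiableOn_plaqReading`) and f8 `…N21ResponseRoadAtRegularSet`
(p598568 ✓: ★★★ `hRT_of_blockExpChart_regular`, ★★★★ `slotAntiConcentration_restrict_of_projectedCentre_blockExpChart_regular`).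

WHY.  File 1 produced f8's NODE-O clause `hΨd` («the plaquette reading of the minimiser is ℂ-differentiable in the
block variables on the regular set») from an ABSTRACT critical branch (continuity + equation + strict differentiability
+ invertible fine Hessian).  Print gives those four in ONE shape — [14] = CMP 102 (1985) 277, Prop. 6 pp. 295–296,
(116)–(121): the fine variables of the minimiser are the FIXED POINT of a contraction `X ↦ −𝔊J − 𝔊((δ∕δA′)V)(X + H₁B)`
in the ball (115), Lipschitz constant `≤ ½` by (120)–(121), analytic in the data («the solution can be constructed as a
uniform limit of successive approximations»); lit-balaban typed the consequence «the equations determine an analytic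
function» (p. 309, Prop. 9) as `analyticAt_fix` ∕ `analyticOnNhd_solA` ∕ `analyticOnNhd_chartH`.  THIS FILE reads f8's
clause in THAT shape: if `Umin z` SELECTS FIXED POINTS of a family `U ↦ T z V U` uniformly `q`-Lipschitz (`q < 1`) on a
set `K z` containing them, jointly `C^ω` in `(V, U)` at the branch, with `‖D_U T‖ < 1` there (Neumann invertibility of
`I − D_U T`), then `Umin z` is ANALYTIC on the open regular set (§1, lit-balaban BY NAME; and §1 shows these binders
IMPLY file 1's four), hence f8's `hΨd` (§2), part 34's `hRT` (§3 ★★★) and its (M1) (§4 ★★★★) hold through the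
exponential block chart with the clause's differentiability half DISCHARGED into print-shaped binders `hfix`
((115)∕(116)), `hlip` ((120)–(121)), `hT` (analytic data, Prop. 4 ∕ p. 309), `hlt`, unit values, and `hΨS` ([14] Thm 1
(8)) — all HYPOTHESES, LOCATED not asserted; nothing instantiated at NODE 00's objects here.

WHAT IS PROVED ([bookkeeping] over lit-balaban's [folklore] lemma and files 1∕f7∕f8; 0 def, 0 sorry).
* §1 `analyticOnNhd_fix_of_contractingFamily` (open parameter set; the pointwise lemma BY NAME) ·
  `criticalBranch_of_contractingFamily` (file 2's binders ⇒ file 1's four: continuity,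
  equation, strict derivative `snd − DT`, invertible fine partial `I − D_X T` with `‖(I − D_X T)⁻¹‖ ≤ (1 − ‖D_X T‖)⁻¹`).
* §2 ★★-c `psiClause_differentiableOn_of_contractingFamily` (readings of the selected fixed points over an open set of
  block data) · ★★′-c `psiClause_plaqReading_of_contractingFamily` = f8's `hΨd` VERBATIM on `Reg` for the plaquette
  readings of a unit-valued fixed-point branch.
* §3 ★★★-c `hRT_of_blockExpChart_regular_of_contractingFamily` = f8 ★★★ BY NAME, `hΨd` DISCHARGED by ★★′-c.
* §4 ★★★★-c `slotAC_of_blockExpChart_regular_of_contractingFamily` = f8 ★★★★ ((M1) on the cut law about the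
  A-projected centre) BY NAME, `hΨd` DISCHARGED by ★★′-c; every other binder of f8 verbatim.
* §5 A2∕A6 `contractingFamily_levelZero_witness`: the binder system of ★★′-c (`hfix`, `hlip`, `hT`, `hlt`, `hunit`) is
  jointly inhabited in every `𝔄` by the LEVEL-0 family `T z V U = ½U + ½V` (`q = ½`, selected fixed point `U = V`,
  linear hence `C^ω`, `‖D_U T‖ ≤ ½`) — stated as an `∃` over the binders.

HONEST FRAMING.  [bookkeeping] composition BY NAME; the identification of `T` with (116)'s map at NODE 00's objects, of
`K z` with the ball (115) and of `Umin` with [14]'s minimiser is a LOCATED dictionary, NOT asserted; (α) itself (radial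
growth at rate `κ₀θ(1 − ρ)` on the shell) is NOT PRINTED and NOT proved; nothing of Bałaban's asserted; (M1) ∕ NE7c NOT
PRINTED ∕ NOT proved; N21 NOT discharged; K3⁷ NOT claimed; counts unmoved (typed 28∕28 · discharged 5∕27, A 5∕28);
count-neutral; one finite 𝕋⁴ at fixed ε — the Yang–Mills mass gap (Clay) is NOT proved by any of this: R4 would close
the conditional finite-𝕋⁴ rung `BalabanLadder.UV` only; nothing continuum ∕ ℝ⁴ ∕ OS ∕ mass gap ∕ Clay.
-/

noncomputable section

open Filter Set Metric NormedSpace MeasureTheory Matrix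
open scoped Topology ContDiff ENNReal

namespace Summit.QuantumFields.YangMills.Theorems.N21MinimiserResponseContraction

open Literature.MathematicalPhysics.QuantumFieldTheory.Balaban1983to89.B11Claim309UAnalytic
  (analyticAt_fix_of_norm_lt_one continuousAt_fix)
open Literature.MathematicalPhysics.QuantumFieldTheory.Balaban1983to89.B12LinearizAnalytic267
  (isInvertible_id_add_of_norm_le)
open Literature.MathematicalPhysics.QuantumFieldTheory.Balaban1983to89.T4ShellMeasure (SlotAntiConcentration)
open Summit.QuantumFields.YangMills.Theorems.N21ExponentialChartFieldStrength
  (isOpen_unitConfigs isOpen_regularConfigs differentiableOn_plaqReading)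
open Summit.QuantumFields.YangMills.Theorems.N21ResponseRoadAtRegularSet
  (hRT_of_blockExpChart_regular slotAntiConcentration_restrict_of_projectedCentre_blockExpChart_regular)

/-! ## §1  The selected fixed point of a uniformly contracting analytic family is analytic on an open parameter set -/

section Fix

variable {E 𝒳 : Type*} [NormedAddCommGroup E] [NormedSpace ℂ E] [CompleteSpace E]
  [NormedAddCommGroup 𝒳] [NormedSpace ℂ 𝒳] [CompleteSpace 𝒳]
  {S : Set E} {K : Set 𝒳} {T : E → 𝒳 → 𝒳} {F : E → 𝒳} {q : ℝ}

/-- **ANALYTIC FIXED-POINT BRANCH ON AN OPEN SET** (lit-balaban `analyticAt_fix_of_norm_lt_one` at every point): a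
selector `F` of fixed points in `K` of a family `T p` uniformly `q`-Lipschitz on `K` (`q < 1`), with `(p, X) ↦ T p X` of
class `C^ω` at the branch points and `‖D_X T‖ < 1` there, is analytic on the open set `S`.  [cite: Balaban1985Variational,
Prop. 6 pp.295–296, p.309] [bookkeeping] -/
theorem analyticOnNhd_fix_of_contractingFamily (hS : IsOpen S) (hfix : ∀ p ∈ S, F p ∈ K ∧ T p (F p) = F p)
    (hlip : ∀ p ∈ S, ∀ x ∈ K, ∀ y ∈ K, ‖T p x - T p y‖ ≤ q * ‖x - y‖) (hq : q < 1)
    (hT : ∀ p ∈ S, ContDiffAt ℂ ω (fun z : E × 𝒳 => T z.1 z.2) (p, F p))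
    (hlt : ∀ p ∈ S, ‖fderiv ℂ (T p) (F p)‖ < 1) : AnalyticOnNhd ℂ F S :=
  fun p hp => analyticAt_fix_of_norm_lt_one hS hfix hlip hq hp (hT p hp) (hlt p hp)

omit [CompleteSpace E] in
/-- **A CONTRACTING FAMILY IS A CRITICAL BRANCH — file 2's binders imply file 1's**: at `p₀` in the open parameter set
the selected fixed point `F` of a uniformly contracting `C^ω` family with `‖D_X T‖ < 1` is CONTINUOUS (lit-balaban
`continuousAt_fix`), SOLVES `X − T p X = 0`, the equation is STRICTLY differentiable with derivative `snd − DT`, and the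
fine partial `(snd − DT) ∘ inr = I − D_X T` is INVERTIBLE with `‖(I − D_X T)⁻¹‖ ≤ (1 − ‖D_X T‖)⁻¹` (Neumann, lit-balaban
`isInvertible_id_add_of_norm_le`) — the hypotheses of file 1's ★ and the premise of its §3 letters. [bookkeeping] -/
theorem criticalBranch_of_contractingFamily (hS : IsOpen S) (hfix : ∀ p ∈ S, F p ∈ K ∧ T p (F p) = F p)
    (hlip : ∀ p ∈ S, ∀ x ∈ K, ∀ y ∈ K, ‖T p x - T p y‖ ≤ q * ‖x - y‖) (hq : q < 1) {p₀ : E} (hp₀ : p₀ ∈ S)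
    (hT : ContDiffAt ℂ ω (fun z : E × 𝒳 => T z.1 z.2) (p₀, F p₀)) (hlt : ‖fderiv ℂ (T p₀) (F p₀)‖ < 1) :
    ContinuousAt F p₀ ∧ F p₀ - T p₀ (F p₀) = 0 ∧
      HasStrictFDerivAt (fun z : E × 𝒳 => z.2 - T z.1 z.2)
        (ContinuousLinearMap.snd ℂ E 𝒳 - fderiv ℂ (fun z : E × 𝒳 => T z.1 z.2) (p₀, F p₀)) (p₀, F p₀) ∧
      ((ContinuousLinearMap.snd ℂ E 𝒳 - fderiv ℂ (fun z : E × 𝒳 => T z.1 z.2) (p₀, F p₀)) ∘L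
          ContinuousLinearMap.inr ℂ E 𝒳).IsInvertible ∧
      ‖((ContinuousLinearMap.snd ℂ E 𝒳 - fderiv ℂ (fun z : E × 𝒳 => T z.1 z.2) (p₀, F p₀)) ∘L
          ContinuousLinearMap.inr ℂ E 𝒳).inverse‖ ≤ (1 - ‖fderiv ℂ (T p₀) (F p₀)‖)⁻¹ := by
  have hω : (ω : ℕ∞ω) ≠ 0 := by simp
  -- continuity of the comparison map `p ↦ T p (F p₀)` from the joint regularity, hence of `F`
  have hcmp : ContinuousAt (fun p : E => T p (F p₀)) p₀ := by
    have h1 : ContinuousAt (fun z : E × 𝒳 => T z.1 z.2) ((fun p : E => (p, F p₀)) p₀) := hT.continuousAt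
    exact ContinuousAt.comp_of_eq h1 (continuousAt_id.prodMk continuousAt_const) rfl
  have hcont : ContinuousAt F p₀ := continuousAt_fix hS hfix hlip hq hp₀ hcmp
  have hsol : F p₀ - T p₀ (F p₀) = 0 := by rw [(hfix p₀ hp₀).2, sub_self]
  -- strict differentiability of the equation
  have hTs : HasStrictFDerivAt (fun z : E × 𝒳 => T z.1 z.2)
      (fderiv ℂ (fun z : E × 𝒳 => T z.1 z.2) (p₀, F p₀)) (p₀, F p₀) := hT.hasStrictFDerivAt hω
  have hg : HasStrictFDerivAt (fun z : E × 𝒳 => z.2 - T z.1 z.2)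
      (ContinuousLinearMap.snd ℂ E 𝒳 - fderiv ℂ (fun z : E × 𝒳 => T z.1 z.2) (p₀, F p₀)) (p₀, F p₀) :=
    hasStrictFDerivAt_snd.sub hTs
  -- the section through `inr` is the fine derivative `D_X T`
  have hsec : fderiv ℂ (T p₀) (F p₀) =
      fderiv ℂ (fun z : E × 𝒳 => T z.1 z.2) (p₀, F p₀) ∘L ContinuousLinearMap.inr ℂ E 𝒳 := by
    have h1 : HasFDerivAt (T p₀)
        (fderiv ℂ (fun z : E × 𝒳 => T z.1 z.2) (p₀, F p₀) ∘L ContinuousLinearMap.inr ℂ E 𝒳) (F p₀) := by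
      have h := hTs.hasFDerivAt.comp (F p₀) (hasFDerivAt_prodMk_right (𝕜 := ℂ) p₀ (F p₀))
      simpa [Function.comp_def] using h
    exact h1.fderiv
  have hpart : (ContinuousLinearMap.snd ℂ E 𝒳 - fderiv ℂ (fun z : E × 𝒳 => T z.1 z.2) (p₀, F p₀)) ∘L
      ContinuousLinearMap.inr ℂ E 𝒳 = ContinuousLinearMap.id ℂ 𝒳 + -fderiv ℂ (T p₀) (F p₀) := by
    rw [ContinuousLinearMap.sub_comp, ContinuousLinearMap.snd_comp_inr, hsec, sub_eq_add_neg]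
  have hN := isInvertible_id_add_of_norm_le (A := -fderiv ℂ (T p₀) (F p₀)) (q := ‖fderiv ℂ (T p₀) (F p₀)‖)
    (by rw [norm_neg]) hlt
  refine ⟨hcont, hsol, hg, ?_, ?_⟩
  · rw [hpart]; exact hN.1
  · rw [hpart]; exact hN.2

end Fix

/-! ## §2  The response road's NODE-O clause (f8's `hΨd`) from a contracting family -/

section PsiClause

variable {𝔄 : Type*} [NormedRing 𝔄] [NormedAlgebra ℂ 𝔄] [CompleteSpace 𝔄]
  {B : Type*} [Fintype B] {Z P : Type*}
  {𝔉 : Type*} [NormedAddCommGroup 𝔉] [NormedSpace ℂ 𝔉] [CompleteSpace 𝔉]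
  {E : Type*} [NormedAddCommGroup E] [NormedSpace ℂ E]

/-- ★★-c **READINGS OF A CONTRACTING FIXED-POINT BRANCH ARE DIFFERENTIABLE** (abstract open set `D` of block data):
for every exterior `z`, `Umin z` selects fixed points in `K z` of `U ↦ T z V U`, uniformly `q`-Lipschitz on `K z`
(`q < 1`), jointly `C^ω` at the branch with `‖D_U T‖ < 1`; readings `read q` ℂ-differentiable at the branch values ⇒
`V ↦ read q (Umin z V)` is ℂ-differentiable on `D`. [cite: Balaban1985Variational, (116)-(121) p.295] [bookkeeping] -/
theorem psiClause_differentiableOn_of_contractingFamily {D : Set (B → 𝔄)} (hD : IsOpen D)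
    (Umin : Z → (B → 𝔄) → 𝔉) (T : Z → (B → 𝔄) → 𝔉 → 𝔉) (K : Z → Set 𝔉) {q : ℝ} (hq : q < 1)
    (hfix : ∀ z, ∀ V ∈ D, Umin z V ∈ K z ∧ T z V (Umin z V) = Umin z V)
    (hlip : ∀ z, ∀ V ∈ D, ∀ x ∈ K z, ∀ y ∈ K z, ‖T z V x - T z V y‖ ≤ q * ‖x - y‖)
    (hT : ∀ z, ∀ V ∈ D, ContDiffAt ℂ ω (fun w : (B → 𝔄) × 𝔉 => T z w.1 w.2) (V, Umin z V))
    (hlt : ∀ z, ∀ V ∈ D, ‖fderiv ℂ (T z V) (Umin z V)‖ < 1)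
    (read : P → 𝔉 → E) (hread : ∀ q z, ∀ V ∈ D, DifferentiableAt ℂ (read q) (Umin z V)) :
    ∀ q z, DifferentiableOn ℂ (fun V => read q (Umin z V)) D := by
  intro q z V hV
  have hUd := (analyticOnNhd_fix_of_contractingFamily hD (hfix z) (hlip z) hq (hT z) (hlt z)).differentiableOn
  exact (hread q z V hV).comp_differentiableWithinAt V (hUd V hV)

/-- ★★′-c **THE PLAQUETTE READINGS OF A CONTRACTING FIXED-POINT BRANCH** — f8's `hΨd` VERBATIM for
`Ψ q z V := ∂(Umin z V)(q) − 1` on `Reg = {V | (∀ b, IsUnit (V b)) ∧ ∀ p ∈ plaqs, ‖∂V(p) − 1‖ < ε}`: fine bond variables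
`Bf → 𝔄`, unit-valued branch, §1 + f7 `differentiableOn_plaqReading`.
[cite: Balaban1985Variational, (116)-(121) p.295] [bookkeeping] -/
theorem psiClause_plaqReading_of_contractingFamily {Bf : Type*} [Fintype Bf] (plaqs : Finset (B × B × B × B))
    (ε : ℝ) (Umin : Z → (B → 𝔄) → (Bf → 𝔄)) (T : Z → (B → 𝔄) → (Bf → 𝔄) → (Bf → 𝔄)) (K : Z → Set (Bf → 𝔄))
    {q : ℝ} (hq : q < 1)
    (hfix : ∀ z, ∀ V ∈ {V : B → 𝔄 | (∀ b, IsUnit (V b)) ∧ ∀ p ∈ plaqs,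
      ‖V p.1 * V p.2.1 * Ring.inverse (V p.2.2.1) * Ring.inverse (V p.2.2.2) - 1‖ < ε},
      Umin z V ∈ K z ∧ T z V (Umin z V) = Umin z V)
    (hlip : ∀ z, ∀ V ∈ {V : B → 𝔄 | (∀ b, IsUnit (V b)) ∧ ∀ p ∈ plaqs,
      ‖V p.1 * V p.2.1 * Ring.inverse (V p.2.2.1) * Ring.inverse (V p.2.2.2) - 1‖ < ε},
      ∀ x ∈ K z, ∀ y ∈ K z, ‖T z V x - T z V y‖ ≤ q * ‖x - y‖)
    (hT : ∀ z, ∀ V ∈ {V : B → 𝔄 | (∀ b, IsUnit (V b)) ∧ ∀ p ∈ plaqs,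
      ‖V p.1 * V p.2.1 * Ring.inverse (V p.2.2.1) * Ring.inverse (V p.2.2.2) - 1‖ < ε},
      ContDiffAt ℂ ω (fun w : (B → 𝔄) × (Bf → 𝔄) => T z w.1 w.2) (V, Umin z V))
    (hlt : ∀ z, ∀ V ∈ {V : B → 𝔄 | (∀ b, IsUnit (V b)) ∧ ∀ p ∈ plaqs,
      ‖V p.1 * V p.2.1 * Ring.inverse (V p.2.2.1) * Ring.inverse (V p.2.2.2) - 1‖ < ε},
      ‖fderiv ℂ (T z V) (Umin z V)‖ < 1)
    (hunit : ∀ z, ∀ V ∈ {V : B → 𝔄 | (∀ b, IsUnit (V b)) ∧ ∀ p ∈ plaqs,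
      ‖V p.1 * V p.2.1 * Ring.inverse (V p.2.2.1) * Ring.inverse (V p.2.2.2) - 1‖ < ε}, ∀ b, IsUnit (Umin z V b)) :
    ∀ (q : Bf × Bf × Bf × Bf) (z : Z), DifferentiableOn ℂ
      (fun V => Umin z V q.1 * Umin z V q.2.1 * Ring.inverse (Umin z V q.2.2.1) * Ring.inverse (Umin z V q.2.2.2) - 1)
      {V : B → 𝔄 | (∀ b, IsUnit (V b)) ∧ ∀ p ∈ plaqs,
        ‖V p.1 * V p.2.1 * Ring.inverse (V p.2.2.1) * Ring.inverse (V p.2.2.2) - 1‖ < ε} :=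
  psiClause_differentiableOn_of_contractingFamily (isOpen_regularConfigs (𝔄 := 𝔄) plaqs ε) Umin T K hq hfix hlip hT
    hlt (fun q (U : Bf → 𝔄) => U q.1 * U q.2.1 * Ring.inverse (U q.2.2.1) * Ring.inverse (U q.2.2.2) - 1)
    (fun q z V hV => ((differentiableOn_plaqReading (𝔄 := 𝔄) q).differentiableAt
      (isOpen_unitConfigs.mem_nhds (hunit z V hV))).sub_const 1)

end PsiClause

/-! ## §3–§4  Junctions BY NAME: part 34's `hRT` and (M1) through the exponential block chart, `hΨd` DISCHARGED -/

section Junction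

variable {𝔄 : Type*} [NormedRing 𝔄] [NormedAlgebra ℂ 𝔄] [CompleteSpace 𝔄] [NormOneClass 𝔄]
  {κ B Bf : Type*} [Fintype κ] [Fintype B] [Fintype Bf] {Z : Type*}

/-- ★★★-c **PART 34's `hRT` THROUGH THE EXPONENTIAL BLOCK CHART, THE NODE-O CLAUSE's DIFFERENTIABILITY HALF DISCHARGED
INTO [14] PROP. 6's CONTRACTION SHAPE** — f8 ★★★ `hRT_of_blockExpChart_regular` BY NAME at `Ψ q z V := ∂(Umin z V)(q) − 1`
with `hΨd := ★★′-c`; displayed instead: `hfix` ((115)∕(116)), `hlip` ((120)–(121)), `hT`, `hlt`, unit values and the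
printed-shaped `hΨS` ([14] Thm 1 (8), LOCATED); every other binder of f8 verbatim; (α) NOT proved. [bookkeeping] -/
theorem hRT_of_blockExpChart_regular_of_contractingFamily [Nonempty Bf]
    (Xd : Z → κ → B → 𝔄) (V₀ : Z → B → 𝔄ˣ)
    {Ξ v v' r S δ ε ϱ R c₀ θ ρ κ₀ : ℝ} (hΞ0 : 0 ≤ Ξ) (hΞ : ∀ z b, ∑ a, ‖Xd z a b‖ ≤ Ξ) (hv0 : 0 ≤ v)
    (hv : ∀ z b, ‖(V₀ z b : 𝔄)‖ ≤ v) (hv' : ∀ z b, ‖(↑(V₀ z b)⁻¹ : 𝔄)‖ ≤ v') (hr : 0 < r) (hS0 : 0 ≤ S)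
    (hsmall : Ξ * Real.exp ((ϱ + r) * Ξ) * v * r * (v' * Real.exp (ϱ * Ξ)) ≤ 1 / 2)
    (plaqs : Finset (B × B × B × B))
    (hbudget : δ + max (Real.exp (ϱ * Ξ) * v + Ξ * Real.exp ((ϱ + r) * Ξ) * v * r)
        (2 * (v' * Real.exp (ϱ * Ξ))) ^ 3 * (2 + 4 * (v' * Real.exp (ϱ * Ξ)) ^ 2) *
        (Ξ * Real.exp ((ϱ + r) * Ξ) * v * r) < ε)
    (Umin : Z → (B → 𝔄) → (Bf → 𝔄)) (T : Z → (B → 𝔄) → (Bf → 𝔄) → (Bf → 𝔄)) (K : Z → Set (Bf → 𝔄))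
    {q : ℝ} (hq : q < 1)
    (hfix : ∀ z, ∀ V ∈ {V : B → 𝔄 | (∀ b, IsUnit (V b)) ∧ ∀ p ∈ plaqs,
      ‖V p.1 * V p.2.1 * Ring.inverse (V p.2.2.1) * Ring.inverse (V p.2.2.2) - 1‖ < ε},
      Umin z V ∈ K z ∧ T z V (Umin z V) = Umin z V)
    (hlip : ∀ z, ∀ V ∈ {V : B → 𝔄 | (∀ b, IsUnit (V b)) ∧ ∀ p ∈ plaqs,
      ‖V p.1 * V p.2.1 * Ring.inverse (V p.2.2.1) * Ring.inverse (V p.2.2.2) - 1‖ < ε},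
      ∀ x ∈ K z, ∀ y ∈ K z, ‖T z V x - T z V y‖ ≤ q * ‖x - y‖)
    (hT : ∀ z, ∀ V ∈ {V : B → 𝔄 | (∀ b, IsUnit (V b)) ∧ ∀ p ∈ plaqs,
      ‖V p.1 * V p.2.1 * Ring.inverse (V p.2.2.1) * Ring.inverse (V p.2.2.2) - 1‖ < ε},
      ContDiffAt ℂ ω (fun w : (B → 𝔄) × (Bf → 𝔄) => T z w.1 w.2) (V, Umin z V))
    (hlt : ∀ z, ∀ V ∈ {V : B → 𝔄 | (∀ b, IsUnit (V b)) ∧ ∀ p ∈ plaqs,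
      ‖V p.1 * V p.2.1 * Ring.inverse (V p.2.2.1) * Ring.inverse (V p.2.2.2) - 1‖ < ε},
      ‖fderiv ℂ (T z V) (Umin z V)‖ < 1)
    (hunit : ∀ z, ∀ V ∈ {V : B → 𝔄 | (∀ b, IsUnit (V b)) ∧ ∀ p ∈ plaqs,
      ‖V p.1 * V p.2.1 * Ring.inverse (V p.2.2.1) * Ring.inverse (V p.2.2.2) - 1‖ < ε}, ∀ b, IsUnit (Umin z V b))
    (hΨS : ∀ (q : Bf × Bf × Bf × Bf) z, ∀ V ∈ {V : B → 𝔄 | (∀ b, IsUnit (V b)) ∧ ∀ p ∈ plaqs,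
      ‖V p.1 * V p.2.1 * Ring.inverse (V p.2.2.1) * Ring.inverse (V p.2.2.2) - 1‖ < ε},
      ‖Umin z V q.1 * Umin z V q.2.1 * Ring.inverse (Umin z V q.2.2.1) * Ring.inverse (Umin z V q.2.2.2) - 1‖ ≤ S)
    (Kc : Z → Set (κ → ℝ)) (hKϱ : ∀ z, ∀ x ∈ Kc z, ‖x‖ ≤ ϱ)
    (hreg : ∀ z, ∀ x ∈ Kc z, ∀ p ∈ plaqs,
      ‖exp (∑ a, (x a : ℂ) • Xd z a p.1) * (V₀ z p.1 : 𝔄) * (exp (∑ a, (x a : ℂ) • Xd z a p.2.1) * (V₀ z p.2.1 : 𝔄)) *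
        Ring.inverse (exp (∑ a, (x a : ℂ) • Xd z a p.2.2.1) * (V₀ z p.2.2.1 : 𝔄)) *
        Ring.inverse (exp (∑ a, (x a : ℂ) • Xd z a p.2.2.2) * (V₀ z p.2.2.2 : 𝔄)) - 1‖ ≤ δ)
    (c : Z → (κ → ℝ)) (hcK : ∀ z, c z ∈ Kc z) (hKR : ∀ z, ∀ w ∈ Kc z, ‖w - c z‖ ≤ R) (hRr : 2 * R < r)
    (hc₀ : ∀ (q : Bf × Bf × Bf × Bf) z,
      ‖Umin z (fun b => exp (∑ a, ((c z a : ℝ) : ℂ) • Xd z a b) * (V₀ z b : 𝔄)) q.1 *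
        Umin z (fun b => exp (∑ a, ((c z a : ℝ) : ℂ) • Xd z a b) * (V₀ z b : 𝔄)) q.2.1 *
        Ring.inverse (Umin z (fun b => exp (∑ a, ((c z a : ℝ) : ℂ) • Xd z a b) * (V₀ z b : 𝔄)) q.2.2.1) *
        Ring.inverse (Umin z (fun b => exp (∑ a, ((c z a : ℝ) : ℂ) • Xd z a b) * (V₀ z b : 𝔄)) q.2.2.2) - 1‖ ≤ c₀)
    {C : Set (Z × (κ → ℝ))} (hCK : ∀ p ∈ C, p.2 ∈ Kc p.1)
    (hnum : c₀ + 4 * (2 * (2 * S) / r ^ 2) * R ^ 2 ≤ (1 - κ₀) * (θ * (1 - ρ))) :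
    let Ψ : (Bf × Bf × Bf × Bf) → Z → (B → 𝔄) → 𝔄 := fun q z V =>
      Umin z V q.1 * Umin z V q.2.1 * Ring.inverse (Umin z V q.2.2.1) * Ring.inverse (Umin z V q.2.2.2) - 1
    ∀ p : Z × (κ → ℝ), θ * (1 - ρ) ≤ (⨆ q, ‖Ψ q p.1 (fun b => exp (∑ a, ((p.2 a : ℝ) : ℂ) • Xd p.1 a b) * (V₀ p.1 b : 𝔄))‖) → (⨆ q, ‖Ψ q p.1 (fun b => exp (∑ a, ((p.2 a : ℝ) : ℂ) • Xd p.1 a b) * (V₀ p.1 b : 𝔄))‖) < θ → p ∈ C → ∀ s : ℝ, 1 ≤ s →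
      θ * (1 - ρ) ≤ (⨆ q, ‖Ψ q p.1 (fun b => exp (∑ a, (((c p.1 + s • (p.2 - c p.1)) a : ℝ) : ℂ) • Xd p.1 a b) * (V₀ p.1 b : 𝔄))‖) → (⨆ q, ‖Ψ q p.1 (fun b => exp (∑ a, (((c p.1 + s • (p.2 - c p.1)) a : ℝ) : ℂ) • Xd p.1 a b) * (V₀ p.1 b : 𝔄))‖) < θ → (p.1, c p.1 + s • (p.2 - c p.1)) ∈ C →
        (⨆ q, ‖Ψ q p.1 (fun b => exp (∑ a, ((p.2 a : ℝ) : ℂ) • Xd p.1 a b) * (V₀ p.1 b : 𝔄))‖) + κ₀ * (θ * (1 - ρ)) * (s - 1) ≤ (⨆ q, ‖Ψ q p.1 (fun b => exp (∑ a, (((c p.1 + s • (p.2 - c p.1)) a : ℝ) : ℂ) • Xd p.1 a b) * (V₀ p.1 b : 𝔄))‖) := by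
  intro Ψ
  exact hRT_of_blockExpChart_regular Xd V₀ hΞ0 hΞ hv0 hv hv' hr hS0 hsmall plaqs hbudget Ψ
    (psiClause_plaqReading_of_contractingFamily plaqs ε Umin T K hq hfix hlip hT hlt hunit)
    (fun q z V hV => hΨS q z V hV) Kc hKϱ hreg c hcK hKR hRr (fun q z => hc₀ q z) hCK hnum

/-- ★★★★-c **(M1) ON THE CUT LAW ABOUT THE A-PROJECTED CENTRE FOR THE CUBE SUP OF PLAQUETTE READINGS OF THE SELECTED
FIXED POINT THROUGH THE EXPONENTIAL BLOCK CHART** — f8 ★★★★ `slotAntiConcentration_restrict_of_projectedCentre_…` BY NAME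
at `Ψ q z V := ∂(Umin z V)(q) − 1` with `hΨd := ★★′-c`; part 34's remaining binders (coercivity, Lipschitz cut action,
obtuseness, farness, envelope, odds `Q`, `hUm`) displayed unchanged — the consumer's currency. LOCATED. [bookkeeping] -/
theorem slotAC_of_blockExpChart_regular_of_contractingFamily [Nonempty Bf] [MeasurableSpace Z] [Nonempty κ]
    (ζ : Measure Z) [SFinite ζ] (A : Matrix κ κ ℝ) (hA : A.IsSymm) {γ G : ℝ} (hγ0 : 0 < γ)
    (hγ : ∀ x : κ → ℝ, γ * ‖x‖ ^ 2 ≤ x ⬝ᵥ (A *ᵥ x))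
    (m : Z → (κ → ℝ)) {c : Z → (κ → ℝ)} (hc : Measurable c) (Pz : Z → (κ → ℝ) → ℝ)
    (Xd : Z → κ → B → 𝔄) (V₀ : Z → B → 𝔄ˣ)
    {Ξ v v' r S δ ε ϱ R c₀ θ ρ κ₀ : ℝ} (hΞ0 : 0 ≤ Ξ) (hΞ : ∀ z b, ∑ a, ‖Xd z a b‖ ≤ Ξ) (hv0 : 0 ≤ v)
    (hv : ∀ z b, ‖(V₀ z b : 𝔄)‖ ≤ v) (hv' : ∀ z b, ‖(↑(V₀ z b)⁻¹ : 𝔄)‖ ≤ v') (hr : 0 < r) (hS0 : 0 ≤ S)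
    (hsmall : Ξ * Real.exp ((ϱ + r) * Ξ) * v * r * (v' * Real.exp (ϱ * Ξ)) ≤ 1 / 2)
    (plaqs : Finset (B × B × B × B))
    (hbudget : δ + max (Real.exp (ϱ * Ξ) * v + Ξ * Real.exp ((ϱ + r) * Ξ) * v * r)
        (2 * (v' * Real.exp (ϱ * Ξ))) ^ 3 * (2 + 4 * (v' * Real.exp (ϱ * Ξ)) ^ 2) *
        (Ξ * Real.exp ((ϱ + r) * Ξ) * v * r) < ε)
    (Umin : Z → (B → 𝔄) → (Bf → 𝔄)) (T : Z → (B → 𝔄) → (Bf → 𝔄) → (Bf → 𝔄)) (K : Z → Set (Bf → 𝔄))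
    {q : ℝ} (hq : q < 1)
    (hfix : ∀ z, ∀ V ∈ {V : B → 𝔄 | (∀ b, IsUnit (V b)) ∧ ∀ p ∈ plaqs,
      ‖V p.1 * V p.2.1 * Ring.inverse (V p.2.2.1) * Ring.inverse (V p.2.2.2) - 1‖ < ε},
      Umin z V ∈ K z ∧ T z V (Umin z V) = Umin z V)
    (hlip : ∀ z, ∀ V ∈ {V : B → 𝔄 | (∀ b, IsUnit (V b)) ∧ ∀ p ∈ plaqs,
      ‖V p.1 * V p.2.1 * Ring.inverse (V p.2.2.1) * Ring.inverse (V p.2.2.2) - 1‖ < ε},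
      ∀ x ∈ K z, ∀ y ∈ K z, ‖T z V x - T z V y‖ ≤ q * ‖x - y‖)
    (hT : ∀ z, ∀ V ∈ {V : B → 𝔄 | (∀ b, IsUnit (V b)) ∧ ∀ p ∈ plaqs,
      ‖V p.1 * V p.2.1 * Ring.inverse (V p.2.2.1) * Ring.inverse (V p.2.2.2) - 1‖ < ε},
      ContDiffAt ℂ ω (fun w : (B → 𝔄) × (Bf → 𝔄) => T z w.1 w.2) (V, Umin z V))
    (hlt : ∀ z, ∀ V ∈ {V : B → 𝔄 | (∀ b, IsUnit (V b)) ∧ ∀ p ∈ plaqs,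
      ‖V p.1 * V p.2.1 * Ring.inverse (V p.2.2.1) * Ring.inverse (V p.2.2.2) - 1‖ < ε},
      ‖fderiv ℂ (T z V) (Umin z V)‖ < 1)
    (hunit : ∀ z, ∀ V ∈ {V : B → 𝔄 | (∀ b, IsUnit (V b)) ∧ ∀ p ∈ plaqs,
      ‖V p.1 * V p.2.1 * Ring.inverse (V p.2.2.1) * Ring.inverse (V p.2.2.2) - 1‖ < ε}, ∀ b, IsUnit (Umin z V b))
    (hΨS : ∀ (q : Bf × Bf × Bf × Bf) z, ∀ V ∈ {V : B → 𝔄 | (∀ b, IsUnit (V b)) ∧ ∀ p ∈ plaqs,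
      ‖V p.1 * V p.2.1 * Ring.inverse (V p.2.2.1) * Ring.inverse (V p.2.2.2) - 1‖ < ε},
      ‖Umin z V q.1 * Umin z V q.2.1 * Ring.inverse (Umin z V q.2.2.1) * Ring.inverse (Umin z V q.2.2.2) - 1‖ ≤ S)
    (Kc : Z → Set (κ → ℝ)) (hKϱ : ∀ z, ∀ x ∈ Kc z, ‖x‖ ≤ ϱ)
    (hreg : ∀ z, ∀ x ∈ Kc z, ∀ p ∈ plaqs,
      ‖exp (∑ a, (x a : ℂ) • Xd z a p.1) * (V₀ z p.1 : 𝔄) * (exp (∑ a, (x a : ℂ) • Xd z a p.2.1) * (V₀ z p.2.1 : 𝔄)) *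
        Ring.inverse (exp (∑ a, (x a : ℂ) • Xd z a p.2.2.1) * (V₀ z p.2.2.1 : 𝔄)) *
        Ring.inverse (exp (∑ a, (x a : ℂ) • Xd z a p.2.2.2) * (V₀ z p.2.2.2 : 𝔄)) - 1‖ ≤ δ)
    (hg : Measurable fun p : Z × (κ → ℝ) => (Kc p.1).indicator (fun w => ENNReal.ofReal (Real.exp
        (-(1 / 2 * ((w - m p.1) ⬝ᵥ (A *ᵥ (w - m p.1))) + Pz p.1 w)))) p.2)
    (hKR : ∀ z, ∀ w ∈ Kc z, ‖w - c z‖ ≤ R) (hRr : 2 * R < r)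
    (hc₀ : ∀ (q : Bf × Bf × Bf × Bf) z,
      ‖Umin z (fun b => exp (∑ a, ((c z a : ℝ) : ℂ) • Xd z a b) * (V₀ z b : 𝔄)) q.1 *
        Umin z (fun b => exp (∑ a, ((c z a : ℝ) : ℂ) • Xd z a b) * (V₀ z b : 𝔄)) q.2.1 *
        Ring.inverse (Umin z (fun b => exp (∑ a, ((c z a : ℝ) : ℂ) • Xd z a b) * (V₀ z b : 𝔄)) q.2.2.1) *
        Ring.inverse (Umin z (fun b => exp (∑ a, ((c z a : ℝ) : ℂ) • Xd z a b) * (V₀ z b : 𝔄)) q.2.2.2) - 1‖ ≤ c₀)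
    (hUm : Measurable fun p : Z × (κ → ℝ) => (⨆ q : Bf × Bf × Bf × Bf,
      ‖Umin p.1 (fun b => exp (∑ a, ((p.2 a : ℝ) : ℂ) • Xd p.1 a b) * (V₀ p.1 b : 𝔄)) q.1 *
        Umin p.1 (fun b => exp (∑ a, ((p.2 a : ℝ) : ℂ) • Xd p.1 a b) * (V₀ p.1 b : 𝔄)) q.2.1 *
        Ring.inverse (Umin p.1 (fun b => exp (∑ a, ((p.2 a : ℝ) : ℂ) • Xd p.1 a b) * (V₀ p.1 b : 𝔄)) q.2.2.1) *
        Ring.inverse (Umin p.1 (fun b => exp (∑ a, ((p.2 a : ℝ) : ℂ) • Xd p.1 a b) * (V₀ p.1 b : 𝔄)) q.2.2.2) - 1‖))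
    {C Env : Set (Z × (κ → ℝ))} (hC : MeasurableSet C) (hEnv : MeasurableSet Env)
    (hCK : ∀ p ∈ C, p.2 ∈ Kc p.1)
    {Q : ℝ} (hθ : 0 < θ) (hρ0 : 0 < ρ) (hρ1 : ρ < 1) (hκ : 0 < κ₀) (hQ0 : 0 ≤ Q)
    (hnum : c₀ + 4 * (2 * (2 * S) / r ^ 2) * R ^ 2 ≤ (1 - κ₀) * (θ * (1 - ρ)))
    (hK : ∀ z, Convex ℝ (Kc z)) (hcK : ∀ z, c z ∈ Kc z)
    (hP : ∀ z, ∀ v ∈ Kc z, ∀ v' ∈ Kc z, Pz z v - Pz z v' ≤ G * ‖v - v'‖) :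
    let Ψ : (Bf × Bf × Bf × Bf) → Z → (B → 𝔄) → 𝔄 := fun q z V =>
      Umin z V q.1 * Umin z V q.2.1 * Ring.inverse (Umin z V q.2.2.1) * Ring.inverse (Umin z V q.2.2.2) - 1
    let U : Z × (κ → ℝ) → ℝ := fun p =>
      ⨆ q, ‖Ψ q p.1 (fun b => exp (∑ a, ((p.2 a : ℝ) : ℂ) • Xd p.1 a b) * (V₀ p.1 b : 𝔄))‖
    let ν : Measure (Z × (κ → ℝ)) := (ζ.prod volume).withDensity fun p : Z × (κ → ℝ) =>
      (Kc p.1).indicator (fun w => ENNReal.ofReal (Real.exp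
        (-(1 / 2 * ((w - m p.1) ⬝ᵥ (A *ᵥ (w - m p.1))) + Pz p.1 w)))) p.2
    (∀ p : Z × (κ → ℝ), θ * (1 - ρ) ≤ U p → U p < θ → p ∈ C → p.2 ∈ Kc p.1 →
        0 ≤ (c p.1 - m p.1) ⬝ᵥ (A *ᵥ (p.2 - c p.1))) →
    (∀ p : Z × (κ → ℝ), θ * (1 - ρ) ≤ U p → U p < θ → p ∈ C → p.2 ∈ Kc p.1 → 2 * G ≤ γ * ‖p.2 - c p.1‖) →
    (∀ l ∈ Icc (1 - 1 / ((Fintype.card κ : ℝ) + 1)) 1, ∀ p : Z × (κ → ℝ),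
        θ * (1 - ρ) ≤ U p → U p < θ → p ∈ C → (p.1, c p.1 + l • (p.2 - c p.1)) ∈ Env) →
    ν (Env \ ({p | U p < θ} ∩ C)) ≤ ENNReal.ofReal Q * ν ({p | U p < θ} ∩ C) →
    SlotAntiConcentration (ν.restrict ({p | U p < θ} ∩ C)) U θ ρ
      (3 * ((Fintype.card κ : ℝ) + 1) * (1 + Q) / (κ₀ * (1 - ρ))) := by
  intro Ψ U ν hobt hfar henv hQ
  exact slotAntiConcentration_restrict_of_projectedCentre_blockExpChart_regular ζ A hA hγ0 hγ m hc Pz Xd V₀ hΞ0 hΞ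
    hv0 hv hv' hr hS0 hsmall plaqs hbudget Ψ
    (psiClause_plaqReading_of_contractingFamily plaqs ε Umin T K hq hfix hlip hT hlt hunit)
    (fun q z V hV => hΨS q z V hV) Kc hKϱ hreg hg hKR hRr (fun q z => hc₀ q z) hUm hC hEnv hCK hθ hρ0 hρ1 hκ hQ0
    hnum hK hcK hP hobt hfar henv hQ

end Junction

/-! ## §5  A2∕A6: the system of ★★′-c is jointly inhabited in every `𝔄` — the level-0 contracting family -/

section Witness

variable {𝔄 : Type*} [NormedRing 𝔄] [NormedAlgebra ℂ 𝔄] [CompleteSpace 𝔄] {B : Type*} [Fintype B] {Z : Type*}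

omit [CompleteSpace 𝔄] in
/-- **A2∕A6 — THE LEVEL-0 CONTRACTING FAMILY INHABITS THE BINDER SYSTEM OF ★★′-c**: with fine variables = block
variables and the selector `Umin z V = V`, the family `T z V U = ½U + ½V` on `K z = univ` with `q = ½` satisfies
`hfix` (selected fixed point), `hlip` (contraction), `hT` (`C^ω`, being linear in `(V, U)`), `hlt`
(`‖D_U T‖ = ‖½·id‖ ≤ ½ < 1`) and `hunit` on the regular set — in EVERY `𝔄`, so ★★′-c ∕ ★★★-c ∕ ★★★★-c are not vacuous in
their branch binders (★★′-c's conclusion at this witness is file 1's `criticalBranch_levelZero_witness`, cited not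
restated).  The genuine family — (116)'s map at NODE 00's objects — is NODE O's object; nothing about it is asserted.
[bookkeeping] -/
theorem contractingFamily_levelZero_witness (plaqs : Finset (B × B × B × B)) (ε : ℝ) :
    ∃ (T : Z → (B → 𝔄) → (B → 𝔄) → (B → 𝔄)) (K : Z → Set (B → 𝔄)) (q : ℝ), q < 1 ∧
      (∀ z : Z, ∀ V ∈ {V : B → 𝔄 | (∀ b, IsUnit (V b)) ∧ ∀ p ∈ plaqs,
          ‖V p.1 * V p.2.1 * Ring.inverse (V p.2.2.1) * Ring.inverse (V p.2.2.2) - 1‖ < ε},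
        V ∈ K z ∧ T z V V = V) ∧
      (∀ z : Z, ∀ V ∈ {V : B → 𝔄 | (∀ b, IsUnit (V b)) ∧ ∀ p ∈ plaqs,
          ‖V p.1 * V p.2.1 * Ring.inverse (V p.2.2.1) * Ring.inverse (V p.2.2.2) - 1‖ < ε},
        ∀ x ∈ K z, ∀ y ∈ K z, ‖T z V x - T z V y‖ ≤ q * ‖x - y‖) ∧
      (∀ z : Z, ∀ V ∈ {V : B → 𝔄 | (∀ b, IsUnit (V b)) ∧ ∀ p ∈ plaqs,
          ‖V p.1 * V p.2.1 * Ring.inverse (V p.2.2.1) * Ring.inverse (V p.2.2.2) - 1‖ < ε},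
        ContDiffAt ℂ ω (fun w : (B → 𝔄) × (B → 𝔄) => T z w.1 w.2) (V, V)) ∧
      (∀ z : Z, ∀ V ∈ {V : B → 𝔄 | (∀ b, IsUnit (V b)) ∧ ∀ p ∈ plaqs,
          ‖V p.1 * V p.2.1 * Ring.inverse (V p.2.2.1) * Ring.inverse (V p.2.2.2) - 1‖ < ε},
        ‖fderiv ℂ (T z V) V‖ < 1) ∧
      (∀ z : Z, ∀ V ∈ {V : B → 𝔄 | (∀ b, IsUnit (V b)) ∧ ∀ p ∈ plaqs,
          ‖V p.1 * V p.2.1 * Ring.inverse (V p.2.2.1) * Ring.inverse (V p.2.2.2) - 1‖ < ε}, ∀ b, IsUnit (V b)) := by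
  refine ⟨fun _ V U => (2 : ℂ)⁻¹ • U + (2 : ℂ)⁻¹ • V, fun _ => univ, 1 / 2, by norm_num,
    fun _ V _ => ⟨mem_univ _, ?_⟩, fun _ V _ x _ y _ => ?_, fun _ V _ => ?_, fun _ V _ => ?_, fun _ V hV => hV.1⟩
  · -- the fixed-point identity `½V + ½V = V`
    show (2 : ℂ)⁻¹ • V + (2 : ℂ)⁻¹ • V = V
    rw [← add_smul]; norm_num
  · -- the contraction letter `q = ½`
    show ‖(2 : ℂ)⁻¹ • x + (2 : ℂ)⁻¹ • V - ((2 : ℂ)⁻¹ • y + (2 : ℂ)⁻¹ • V)‖ ≤ 1 / 2 * ‖x - y‖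
    have h : (2 : ℂ)⁻¹ • x + (2 : ℂ)⁻¹ • V - ((2 : ℂ)⁻¹ • y + (2 : ℂ)⁻¹ • V) = (2 : ℂ)⁻¹ • (x - y) := by
      rw [smul_sub]; abel
    rw [h, norm_smul]
    norm_num
  · -- joint analyticity: the family is a continuous linear map of `(V, U)`
    exact ((contDiff_snd.const_smul (2 : ℂ)⁻¹).add (contDiff_fst.const_smul (2 : ℂ)⁻¹)).contDiffAt
  · -- `‖D_U T‖ = ‖½ • id‖ ≤ ½ < 1`
    show ‖fderiv ℂ (fun U : B → 𝔄 => (2 : ℂ)⁻¹ • U + (2 : ℂ)⁻¹ • V) V‖ < 1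
    have hd : HasFDerivAt (fun U : B → 𝔄 => (2 : ℂ)⁻¹ • U + (2 : ℂ)⁻¹ • V)
        ((2 : ℂ)⁻¹ • ContinuousLinearMap.id ℂ (B → 𝔄)) V :=
      ((hasFDerivAt_id V).const_smul (2 : ℂ)⁻¹).add_const _
    rw [hd.fderiv]
    have h1 : ‖ContinuousLinearMap.id ℂ (B → 𝔄)‖ ≤ 1 := ContinuousLinearMap.norm_id_le
    have h2 : ‖(2 : ℂ)⁻¹‖ = 1 / 2 := by simp
    calc ‖(2 : ℂ)⁻¹ • ContinuousLinearMap.id ℂ (B → 𝔄)‖ ≤ ‖(2 : ℂ)⁻¹‖ * ‖ContinuousLinearMap.id ℂ (B → 𝔄)‖ :=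
          ContinuousLinearMap.opNorm_smul_le _ _
      _ ≤ 1 / 2 * 1 := by rw [h2]; exact mul_le_mul_of_nonneg_left h1 (by norm_num)
      _ < 1 := by norm_num

end Witness

end Summit.QuantumFields.YangMills.Theorems.N21MinimiserResponseContraction
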